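import Summits.Ventures.QEDPrecision.BubbleChains.MasterRecurrence
import Literature.MathematicalPhysics.QuantumFieldTheory.Jegerlehner2017.VacuumPolarizationInsertion

/-!
# Sixth-order double bubble, I: exact reduction of `∫_ε^1 (1−x) K(x)² dx` to six convergent masters

HONEST FRAMING: independent recomputation; certified where stated, statistical where stated; no new-physics claim.

Cell `pub-qed`, unit `pub-qed-lit`, Route D for `vpChain 2 1` (see `DoubleBubble.lean` for the theorem).
`K(x) = −Π₂(s_x) = 4/(3x²) − 4/(3x) − 5/9 + (x³−6x+4)/(3x³) log(1−x)` is the closed one-loop insertion kernel of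
`Jegerlehner2017.neg_piOneLoop_sX_eq`. Stage 1 `closedKernel_pow2_expand`: `(1−x)K(x)² = Σ c_{k,q} x^{−q} logᵏ(1−x)`
(21 terms, rational coefficients). Stage 2 `integral_closedKernel_pow2_eq_sum`: linearity on `[ε,1]`, `0 < ε < 1`
(every term is integrable there). Stage 3 `integral_closedKernel_pow2_reduced`: the recurrences of
`MasterRecurrence.lean` eliminate every master with a pole of order `≥ 2`, leaving an explicit elementary function
of `ε` and `log(1−ε)` plus the six kept masters `∫ x logᵏ(1−x)`, `∫ logᵏ(1−x)`, `∫ x⁻¹ logᵏ(1−x)` (`k = 1, 2`) on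
`[ε,1]`. The rational coefficients were generated by exact bookkeeping outside Lean (cell folder
`certs/RouteD/`) and are CHECKED here by `ring` / `linear_combination`: the kernel, not the generator, is the
authority. Our own work (new mathematics is only the bookkeeping; the analysis is folklore).
-/

noncomputable section

open Real Set MeasureTheory intervalIntegral Filter Topology

namespace Summit.Ventures.QEDPrecision.BubbleChains

/-- Pointwise expansion of `(1−x)·K(x)^2` into the masters' integrands `x^{−q} (log (1−x))^k`
(exact rational coefficients; `x ≠ 0`). [folklore] -/
theorem closedKernel_pow2_expand {x : ℝ} (hx : x ≠ 0) :
    (1 - x) * (4 / (3 * x ^ 2) - 4 / (3 * x) - 5 / 9 + (x ^ 3 - 6 * x + 4) / (3 * x ^ 3) * log (1 -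
        x)) ^ 2
      = (-25/81 : ℝ) * (x)
      + (-95/81 : ℝ)
      + (32/27 : ℝ) * (x⁻¹)
      + (104/27 : ℝ) * ((x ^ 2)⁻¹)
      + (-16/3 : ℝ) * ((x ^ 3)⁻¹)
      + (16/9 : ℝ) * ((x ^ 4)⁻¹)
      + (10/27 : ℝ) * (x * log (1 - x))
      + (14/27 : ℝ) * (log (1 - x))
      + (-4 : ℝ) * (x⁻¹ * log (1 - x))
      + (-20/27 : ℝ) * ((x ^ 2)⁻¹ * log (1 - x))
      + (344/27 : ℝ) * ((x ^ 3)⁻¹ * log (1 - x))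
      + (-112/9 : ℝ) * ((x ^ 4)⁻¹ * log (1 - x))
      + (32/9 : ℝ) * ((x ^ 5)⁻¹ * log (1 - x))
      + (-1/9 : ℝ) * (x * log (1 - x) ^ 2)
      + (1/9 : ℝ) * (log (1 - x) ^ 2)
      + (4/3 : ℝ) * (x⁻¹ * log (1 - x) ^ 2)
      + (-20/9 : ℝ) * ((x ^ 2)⁻¹ * log (1 - x) ^ 2)
      + (-28/9 : ℝ) * ((x ^ 3)⁻¹ * log (1 - x) ^ 2)
      + (28/3 : ℝ) * ((x ^ 4)⁻¹ * log (1 - x) ^ 2)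
      + (-64/9 : ℝ) * ((x ^ 5)⁻¹ * log (1 - x) ^ 2)
      + (16/9 : ℝ) * ((x ^ 6)⁻¹ * log (1 - x) ^ 2) := by
  field_simp
  ring

/-- `∫_ε^1 (1−x)K^2 = Σ c · J(k,q;ε)` (linearity; every master is integrable on `[ε,1]`).
[folklore] -/
theorem integral_closedKernel_pow2_eq_sum {ε : ℝ} (hε : 0 < ε) (hε1 : ε < 1) :
    ∫ x in ε..1, (1 - x) * (4 / (3 * x ^ 2) - 4 / (3 * x) - 5 / 9 + (x ^ 3 - 6 * x + 4) / (3 * x ^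
        3) * log (1 - x)) ^ 2
      = (-25/81 : ℝ) * (∫ x in ε..1, x)
      + (-95/81 : ℝ) * (∫ _x in ε..1, (1:ℝ))
      + (32/27 : ℝ) * (∫ x in ε..1, x⁻¹)
      + (104/27 : ℝ) * (∫ x in ε..1, (x ^ 2)⁻¹)
      + (-16/3 : ℝ) * (∫ x in ε..1, (x ^ 3)⁻¹)
      + (16/9 : ℝ) * (∫ x in ε..1, (x ^ 4)⁻¹)
      + (10/27 : ℝ) * (∫ x in ε..1, x * log (1 - x))
      + (14/27 : ℝ) * (∫ x in ε..1, log (1 - x))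
      + (-4 : ℝ) * (∫ x in ε..1, x⁻¹ * log (1 - x))
      + (-20/27 : ℝ) * (∫ x in ε..1, (x ^ 2)⁻¹ * log (1 - x))
      + (344/27 : ℝ) * (∫ x in ε..1, (x ^ 3)⁻¹ * log (1 - x))
      + (-112/9 : ℝ) * (∫ x in ε..1, (x ^ 4)⁻¹ * log (1 - x))
      + (32/9 : ℝ) * (∫ x in ε..1, (x ^ 5)⁻¹ * log (1 - x))
      + (-1/9 : ℝ) * (∫ x in ε..1, x * log (1 - x) ^ 2)
      + (1/9 : ℝ) * (∫ x in ε..1, log (1 - x) ^ 2)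
      + (4/3 : ℝ) * (∫ x in ε..1, x⁻¹ * log (1 - x) ^ 2)
      + (-20/9 : ℝ) * (∫ x in ε..1, (x ^ 2)⁻¹ * log (1 - x) ^ 2)
      + (-28/9 : ℝ) * (∫ x in ε..1, (x ^ 3)⁻¹ * log (1 - x) ^ 2)
      + (28/3 : ℝ) * (∫ x in ε..1, (x ^ 4)⁻¹ * log (1 - x) ^ 2)
      + (-64/9 : ℝ) * (∫ x in ε..1, (x ^ 5)⁻¹ * log (1 - x) ^ 2)
      + (16/9 : ℝ) * (∫ x in ε..1, (x ^ 6)⁻¹ * log (1 - x) ^ 2) := by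
  have hI : ∀ (m : ℤ) (j : ℕ), IntervalIntegrable (fun x : ℝ => x ^ m * log (1 - x) ^ j) volume ε 1
      :=
    fun m j => intervalIntegrable_zpow_mul_log_one_sub_pow m j hε hε1.le
  -- every monomial integrand, in the displayed normal form, is integrable on [ε,1]
  have hJ : ∀ (q : ℤ) (j : ℕ), IntervalIntegrable (fun x : ℝ => x ^ (-q) * log (1 - x) ^ j) volume
      ε 1 :=
    fun q j => hI (-q) j
  have h_eq : EqOn (fun x : ℝ => (1 - x) * (4 / (3 * x ^ 2) - 4 / (3 * x) - 5 / 9 + (x ^ 3 - 6 * x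
      + 4) / (3 * x ^ 3) * log (1 - x)) ^ 2)
      (fun x : ℝ => (-25/81 : ℝ) * (x)
      + (-95/81 : ℝ)
      + (32/27 : ℝ) * (x⁻¹)
      + (104/27 : ℝ) * ((x ^ 2)⁻¹)
      + (-16/3 : ℝ) * ((x ^ 3)⁻¹)
      + (16/9 : ℝ) * ((x ^ 4)⁻¹)
      + (10/27 : ℝ) * (x * log (1 - x))
      + (14/27 : ℝ) * (log (1 - x))
      + (-4 : ℝ) * (x⁻¹ * log (1 - x))
      + (-20/27 : ℝ) * ((x ^ 2)⁻¹ * log (1 - x))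
      + (344/27 : ℝ) * ((x ^ 3)⁻¹ * log (1 - x))
      + (-112/9 : ℝ) * ((x ^ 4)⁻¹ * log (1 - x))
      + (32/9 : ℝ) * ((x ^ 5)⁻¹ * log (1 - x))
      + (-1/9 : ℝ) * (x * log (1 - x) ^ 2)
      + (1/9 : ℝ) * (log (1 - x) ^ 2)
      + (4/3 : ℝ) * (x⁻¹ * log (1 - x) ^ 2)
      + (-20/9 : ℝ) * ((x ^ 2)⁻¹ * log (1 - x) ^ 2)
      + (-28/9 : ℝ) * ((x ^ 3)⁻¹ * log (1 - x) ^ 2)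
      + (28/3 : ℝ) * ((x ^ 4)⁻¹ * log (1 - x) ^ 2)
      + (-64/9 : ℝ) * ((x ^ 5)⁻¹ * log (1 - x) ^ 2)
      + (16/9 : ℝ) * ((x ^ 6)⁻¹ * log (1 - x) ^ 2)) (uIcc ε 1) := by
    intro x hx
    rw [uIcc_of_le hε1.le] at hx
    have hx0 : x ≠ 0 := by linarith [hx.1]
    simp only
    exact closedKernel_pow2_expand hx0
  rw [intervalIntegral.integral_congr h_eq]

  -- pass through a `Fin 21`-indexed sum
  have hsum_fun : (fun x : ℝ => (-25/81 : ℝ) * (x)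
      + (-95/81 : ℝ)
      + (32/27 : ℝ) * (x⁻¹)
      + (104/27 : ℝ) * ((x ^ 2)⁻¹)
      + (-16/3 : ℝ) * ((x ^ 3)⁻¹)
      + (16/9 : ℝ) * ((x ^ 4)⁻¹)
      + (10/27 : ℝ) * (x * log (1 - x))
      + (14/27 : ℝ) * (log (1 - x))
      + (-4 : ℝ) * (x⁻¹ * log (1 - x))
      + (-20/27 : ℝ) * ((x ^ 2)⁻¹ * log (1 - x))
      + (344/27 : ℝ) * ((x ^ 3)⁻¹ * log (1 - x))
      + (-112/9 : ℝ) * ((x ^ 4)⁻¹ * log (1 - x))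
      + (32/9 : ℝ) * ((x ^ 5)⁻¹ * log (1 - x))
      + (-1/9 : ℝ) * (x * log (1 - x) ^ 2)
      + (1/9 : ℝ) * (log (1 - x) ^ 2)
      + (4/3 : ℝ) * (x⁻¹ * log (1 - x) ^ 2)
      + (-20/9 : ℝ) * ((x ^ 2)⁻¹ * log (1 - x) ^ 2)
      + (-28/9 : ℝ) * ((x ^ 3)⁻¹ * log (1 - x) ^ 2)
      + (28/3 : ℝ) * ((x ^ 4)⁻¹ * log (1 - x) ^ 2)
      + (-64/9 : ℝ) * ((x ^ 5)⁻¹ * log (1 - x) ^ 2)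
      + (16/9 : ℝ) * ((x ^ 6)⁻¹ * log (1 - x) ^ 2))
      = fun x : ℝ => ∑ i : Fin 21, (![(-25/81 : ℝ), (-95/81 : ℝ), (32/27 : ℝ), (104/27 : ℝ), (-16/3
          : ℝ), (16/9 : ℝ), (10/27 : ℝ), (14/27 : ℝ), (-4 : ℝ), (-20/27 : ℝ), (344/27 : ℝ), (-112/9
          : ℝ), (32/9 : ℝ), (-1/9 : ℝ), (1/9 : ℝ), (4/3 : ℝ), (-20/9 : ℝ), (-28/9 : ℝ), (28/3 : ℝ),
          (-64/9 : ℝ), (16/9 : ℝ)] i : ℝ) * (x ^ (-(![(-1 : ℤ), (0 : ℤ), (1 : ℤ), (2 : ℤ), (3 : ℤ),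
          (4 : ℤ), (-1 : ℤ), (0 : ℤ), (1 : ℤ), (2 : ℤ), (3 : ℤ), (4 : ℤ), (5 : ℤ), (-1 : ℤ), (0 :
          ℤ), (1 : ℤ), (2 : ℤ), (3 : ℤ), (4 : ℤ), (5 : ℤ), (6 : ℤ)] i)) * log (1 - x) ^ (![(0 : ℕ),
          (0 : ℕ), (0 : ℕ), (0 : ℕ), (0 : ℕ), (0 : ℕ), (1 : ℕ), (1 : ℕ), (1 : ℕ), (1 : ℕ), (1 : ℕ),
          (1 : ℕ), (1 : ℕ), (2 : ℕ), (2 : ℕ), (2 : ℕ), (2 : ℕ), (2 : ℕ), (2 : ℕ), (2 : ℕ), (2 : ℕ)]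
          i)) := by
    funext x
    simp only [Fin.sum_univ_succ, Fin.sum_univ_zero, Matrix.cons_val_zero, Matrix.cons_val_succ,
      Matrix.cons_val_fin_one]
    simp only [zpow_neg, zpow_ofNat, neg_neg, pow_zero, pow_one, mul_one, one_mul, neg_zero]
    ring
  rw [hsum_fun, intervalIntegral.integral_finsetSum (fun i _ => (hJ _ _).const_mul _)]
  simp only [intervalIntegral.integral_const_mul, Fin.sum_univ_succ, Fin.sum_univ_zero,
      Matrix.cons_val_zero,
    Matrix.cons_val_succ, Matrix.cons_val_fin_one]
  simp only [zpow_neg, zpow_ofNat, neg_neg, pow_zero, pow_one, mul_one, one_mul, neg_zero]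
  ring

/-- **Reduction of `∫_ε^1 (1−x)K^2` to the kept masters** by the integration-by-parts
recurrences (`master_recurrence`) and the elementary `k = 0` integrals; exact for every
`0 < ε < 1`. [folklore] -/
theorem integral_closedKernel_pow2_reduced {ε : ℝ} (hε : 0 < ε) (hε1 : ε < 1) :
    ∫ x in ε..1, (1 - x) * (4 / (3 * x ^ 2) - 4 / (3 * x) - 5 / 9 + (x ^ 3 - 6 * x + 4) / (3 * x ^
        3) * log (1 - x)) ^ 2
      = ((-311/162 : ℝ)
        + (16/45 : ℝ) * ((ε ^ 5)⁻¹ * log (1 - ε) ^ 2)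
        + (32/45 : ℝ) * ((ε ^ 4)⁻¹ * log (1 - ε))
        + (-16/9 : ℝ) * ((ε ^ 4)⁻¹ * log (1 - ε) ^ 2)
        + (16/45 : ℝ) * ((ε ^ 3)⁻¹)
        + (-16/5 : ℝ) * ((ε ^ 3)⁻¹ * log (1 - ε))
        + (28/9 : ℝ) * ((ε ^ 3)⁻¹ * log (1 - ε) ^ 2)
        + (-64/45 : ℝ) * ((ε ^ 2)⁻¹)
        + (632/135 : ℝ) * ((ε ^ 2)⁻¹ * log (1 - ε))
        + (-14/9 : ℝ) * ((ε ^ 2)⁻¹ * log (1 - ε) ^ 2)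
        + (224/135 : ℝ) * (ε⁻¹)
        + (-136/135 : ℝ) * (ε⁻¹ * log (1 - ε))
        + (-20/9 : ℝ) * (ε⁻¹ * log (1 - ε) ^ 2)
        + (-32/27 : ℝ) * (log (1 - ε))
        + (94/45 : ℝ) * (log (1 - ε) ^ 2)
        + (95/81 : ℝ) * (ε)
        + (25/162 : ℝ) * (ε ^ 2))
      + (10/27 : ℝ) * (∫ x in ε..1, x * log (1 - x))
      + (14/27 : ℝ) * (∫ x in ε..1, log (1 - x))
      + (8/45 : ℝ) * (∫ x in ε..1, x⁻¹ * log (1 - x))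
      + (-1/9 : ℝ) * (∫ x in ε..1, x * log (1 - x) ^ 2)
      + (1/9 : ℝ) * (∫ x in ε..1, log (1 - x) ^ 2)
      + (4/3 : ℝ) * (∫ x in ε..1, x⁻¹ * log (1 - x) ^ 2) := by
  rw [integral_closedKernel_pow2_eq_sum hε hε1]
  have hε0 : ε ≠ 0 := hε.ne'
  have r_1_2 := master_recurrence 1 1 hε hε1
  have r_1_3 := master_recurrence 2 1 hε hε1
  have r_1_4 := master_recurrence 3 1 hε hε1
  have r_1_5 := master_recurrence 4 1 hε hε1
  have r_2_2 := master_recurrence 1 2 hε hε1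
  have r_2_3 := master_recurrence 2 2 hε hε1
  have r_2_4 := master_recurrence 3 2 hε hε1
  have r_2_5 := master_recurrence 4 2 hε hε1
  have r_2_6 := master_recurrence 5 2 hε hε1
  have z_2 := integral_zpow_neg_succ 1 (by norm_num) hε hε1.le
  have z_3 := integral_zpow_neg_succ 2 (by norm_num) hε hε1.le
  have z_4 := integral_zpow_neg_succ 3 (by norm_num) hε hε1.le
  have w_1 : ∫ x in ε..1, x = (1 - ε ^ 2) / 2 := by rw [integral_id]; ring
  have w_0 : ∫ _x in ε..1, (1:ℝ) = 1 - ε := by simp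
  simp only [Finset.sum_range_succ, Finset.sum_range_zero, Nat.cast_zero, Nat.cast_one,
      Nat.cast_ofNat, zero_add, zpow_neg, zpow_ofNat, pow_one, one_mul]
    at r_1_2 r_1_3 r_1_4 r_1_5 r_2_2 r_2_3 r_2_4 r_2_5 r_2_6 z_2
      z_3 z_4
  norm_num [zpow_neg, zpow_ofNat]
    at r_1_2 r_1_3 r_1_4 r_1_5 r_2_2 r_2_3 r_2_4 r_2_5 r_2_6 z_2
      z_3 z_4
  linear_combination ((136/135 : ℝ)) * r_1_2 + ((-632/135 : ℝ)) * r_1_3 + ((16/5 : ℝ)) * r_1_4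
    + ((-32/45 : ℝ)) * r_1_5 + ((20/9 : ℝ)) * r_2_2 + ((14/9 : ℝ)) * r_2_3
    + ((-28/9 : ℝ)) * r_2_4 + ((16/9 : ℝ)) * r_2_5 + ((-16/45 : ℝ)) * r_2_6
    + ((224/135 : ℝ)) * z_2 + ((-128/45 : ℝ)) * z_3 + ((16/15 : ℝ)) * z_4
    + ((-25/81 : ℝ)) * w_1 + ((-95/81 : ℝ)) * w_0

end Summit.Ventures.QEDPrecision.BubbleChains

end
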